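import Summits.CriticalPhenomena.CardyFormulaZ2.Theorems.CardyBoundaryCoulombGasHalfPlaneMarkDensityLawPosDensityPositivity
import Summits.CriticalPhenomena.CardyFormulaZ2.Theorems.CardyBoundaryCoulombGasHalfPlaneMarkDensityLawTwoArmPoint

/-!
# `HalfPlaneMarkDensityLaw` (crux stmt-CriticalPhenomena-5661), line `Sketch`, lead c12-0:
# the registered stub `stub_twoArmExtendability` — now a COROLLARY of positivity

Cycle 1 registered the outer extendability of the boundary two-arm event,
`cE · P[liso ⌊xn⌋ ⌊θn⌋] ≤ P[E_n(a,b,c,x)]` eventually, as the missing (arm-separation) input for the positivity of the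
mark density.  Cycle 4 proved positivity WITHOUT it (`TwoArmLower.stub_densityPositivity`, p133107); together with
the tree's two-arm point UPPER bound `P[liso k R] ≤ C/R` (`stub_twoArmPoint`) extendability follows at once:
`P[E_n] ≥ c₁/n ≥ (c₁/C')·P[liso ⌊xn⌋ n]`, `C' = max C 1`, `θ = 1`.
-/

noncomputable section

namespace Summit.CriticalPhenomena.CardyFormulaZ2.Cruxes.HalfPlaneMarkDensityLaw.SketchLine

open Literature.Probability.Percolation Literature.Probability.LatticeModels
open MeasureTheory Filter Set
open scoped Topology
open Summit.CriticalPhenomena.CardyFormulaZ2.Theorems.HalfPlaneMarkDensityLaw.Negative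

namespace TwoArmLower

/-- **Outer extendability of the boundary two-arm event** (registered stub `stub_twoArmExtendability`): for
`a < b < c < x` there are `cE, θ > 0` with `cE · P[liso ⌊xn⌋ ⌊θn⌋] ≤ P[E_n(a,b,c,x)]` for all large `n` — from the
positivity of the mark density and the two-arm point upper bound, with `θ = 1`. [folklore] -/
theorem stub_twoArmExtendability :
    ∀ (a b c x : ℝ), a < b → b < c → c < x → ∃ cE θ : ℝ, 0 < cE ∧ 0 < θ ∧ ∀ᶠ n : ℕ in atTop,
      cE * μ.real (TwoArm.liso ⌊x * n⌋ ⌊θ * n⌋₊) ≤ μ.real (markEvent a b c x n) := by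
  intro a b c x hab hbc hcx
  obtain ⟨c₁, hc₁, hev⟩ := stub_densityPositivity a b c x hab hbc hcx
  obtain ⟨C, hC⟩ : ∃ C : ℝ, ∀ (k : ℤ) (R : ℕ), 1 ≤ R →
      μ.real (TwoArm.liso k R) ≤ C / R ∧ μ.real (TwoArm.riso k R) ≤ C / R := stub_twoArmPoint
  set C' : ℝ := max C 1 with hC'
  have hC'pos : 0 < C' := lt_of_lt_of_le one_pos (le_max_right _ _)
  refine ⟨c₁ / C', 1, by positivity, one_pos, ?_⟩
  filter_upwards [hev, eventually_ge_atTop 1] with n hn hn1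
  have hfloor : ⌊(1 : ℝ) * n⌋₊ = n := by simp
  rw [hfloor]
  have hnpos : (0 : ℝ) < n := by exact_mod_cast hn1
  -- the two-arm point upper bound at radius `n`
  have hl : μ.real (TwoArm.liso ⌊x * n⌋ n) ≤ C' / n :=
    ((hC _ _ hn1).1).trans (div_le_div_of_nonneg_right (le_max_left _ _) hnpos.le)
  -- positivity: `c₁ ≤ n · P[E_n]`
  have hpos : c₁ / n ≤ μ.real (markEvent a b c x n) := by
    rw [div_le_iff₀ hnpos, mul_comm]
    exact hn
  calc c₁ / C' * μ.real (TwoArm.liso ⌊x * n⌋ n) ≤ c₁ / C' * (C' / n) :=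
        mul_le_mul_of_nonneg_left hl (by positivity)
    _ = c₁ / n := by field_simp
    _ ≤ μ.real (markEvent a b c x n) := hpos

end TwoArmLower

end Summit.CriticalPhenomena.CardyFormulaZ2.Cruxes.HalfPlaneMarkDensityLaw.SketchLine
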